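import Summits.QuantumFields.YangMills.Theorems.IR.TensionRatioDefs
import Literature.MathematicalPhysics.QuantumFieldTheory.TorusWilsonLoopRepGramBounds
import Literature.MathematicalPhysics.QuantumFieldTheory.LatticeGaugePlaquetteLowerBound
import HarnessLib

/-!
# Crux `IR` (stmt-QuantumFields-19354), line `tension-ratio`: the window rung T2-sc-window-RP PROVED —
`ratioStrongCouplingWindowRP_holds : RatioStrongCouplingWindowRP`

Helper module for item `stmt-QuantumFields-19354` (`--supports … --as helper`): the registered rung stub
`TensionRatio.stub_rung_ratioStrongCouplingWindowRP : RatioStrongCouplingWindowRP` of skeleton v1.4 `Cruxes/IR/Lines/ym_ir7_tension_ratio.lean`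
(statement = tree constant of `Theorems/IR/TensionRatioDefs.lean` §4) closes by `exact ratioStrongCouplingWindowRP_holds`.

**Proof** (the ideator's recipe, card v1.5 «Supplier update»; three tree inputs + arithmetic).  `βD := min β₂ (strongCouplingRadius r.ρ)` with
`β₂` from the strong-coupling plaquette floor; on a window `[β₁, βD]` put `w := c_pl β₁ > 0`, `ℓ := max (−log w) 1`, `c := 1/(8√ℓ)`.
(i) `exists_plaquette_ge_linear` (from `PlaquetteLowerBound.wilsonExpectation_plaquette_ge`, SU(N) fundamental model, every torus of side `≥ 3`,
`0 < β ≤ β₂`): `⟨W_{1×1}⟩_L ≥ c_pl β ≥ w`; (ii) the torus Seiler/Bachas RP bound `plaquette_pow_le_wilsonExpectation_wilsonLoopRep` (p592927, even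
`L`): `⟨W_{1×1}⟩^{n²} ≤ ⟨W_{n×n}⟩` on the torus `2n`; (iii) the hypothesised area law at `R = T = n`, `L = 2n`: `⟨W_{n×n}⟩ ≤ C^{4n} e^{−s n²}`.
Hence `w^{n²} ≤ (|C|+1)^{4n} e^{−s n²}` for all large `n`, so `s ≤ −log w ≤ ℓ` (`rate_le_neg_log_of_areaLaw`), `c√s ≤ 1/8`, and the tree's
strong-coupling cold pressure at rate `1/8` (`ColdPressurePincer.coldPressureAt_strongCoupling`, `0 ≤ β ≤ strongCouplingRadius r.ρ`) lowered by
`coldPressureBound_mono_rate` is the conclusion.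

HONEST FRAMING: a FORMAT rung inside the known strong-coupling regime (it exercises T2's interfaces: area-law hypothesis ⇒ rate cap ⇒ cold
pressure at rate `∝ √s`); not a BC5 witness, not consumed by `IR_of`; `TensionFloor`/`RatioFloorSC` stay OPEN; the YM mass gap (Clay) is NOT
proved; `R4` closes only the conditional rung `BalabanLadder.UV`.
Refs: E. Seiler, Phys. Rev. D 18 (1978) 482 (RP lower bound); K. Osterwalder, E. Seiler, Ann. Phys. 110 (1978) 440 §3; tree files named above.
-/

set_option autoImplicit false

noncomputable section

open MeasureTheory Filter Topology
open Literature.MathematicalPhysics Literature.MathematicalPhysics.QuantumFieldTheory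
open Literature.MathematicalPhysics.QuantumFieldTheory.PlaquetteLowerBound (charVariance charVariance_pos wilsonExpectation_plaquette_ge)
open Literature.MathematicalPhysics.QuantumFieldTheory.Balaban1983to89.Sufficient (ColdPressureBound)
open Literature.MathematicalPhysics.QuantumFieldTheory.Balaban1983to89.Missing (strongCouplingRadius strongCouplingRadius_pos)
open Summit.QuantumFields.YangMills.Cruxes.IR.ColdPressurePincer

namespace Summit.QuantumFields.YangMills.Cruxes.IR.TensionRatio

/-! ## §1 Arithmetic of the rate cap (no gauge theory) -/

/-- **Rate cap.**  If `w^{n²} ≤ D^{2(n+n)} e^{−s n²}` for all large `n` with `w > 0`, `D ≥ 1`, then `s ≤ −log w`. -/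
theorem rate_le_neg_log_of_areaLaw {w D s : ℝ} (hw : 0 < w) (hD : 1 ≤ D) {n₀ : ℕ}
    (h : ∀ n : ℕ, n₀ ≤ n → w ^ (n * n) ≤ D ^ (2 * (n + n)) * Real.exp (-(s * n * n))) : s ≤ -Real.log w := by
  by_contra hcon
  have hcon' : -Real.log w < s := lt_of_not_ge hcon
  obtain ⟨δ, hδ⟩ : ∃ δ : ℝ, δ = s + Real.log w := ⟨_, rfl⟩
  have hδ0 : 0 < δ := by rw [hδ]; linarith
  have hD0 : 0 < D := lt_of_lt_of_le one_pos hD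
  have key : ∀ n : ℕ, n₀ ≤ n → 1 ≤ n → (n : ℝ) * δ ≤ 4 * Real.log D := by
    intro n hn hn1
    have hn0 : (0 : ℝ) < n := by exact_mod_cast hn1
    have h1 := h n hn
    have h2 := Real.log_le_log (pow_pos hw _) h1
    rw [Real.log_pow, Real.log_mul (pow_pos hD0 _).ne' (Real.exp_pos _).ne', Real.log_pow, Real.log_exp] at h2
    push_cast at h2
    have h3 : (n : ℝ) * ((n : ℝ) * δ) ≤ (n : ℝ) * (4 * Real.log D) := by
      rw [hδ]; nlinarith [h2]
    exact le_of_mul_le_mul_left h3 hn0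
  obtain ⟨n, hn⟩ := exists_nat_gt (4 * Real.log D / δ)
  have hk := key (max n (max n₀ 1)) ((le_max_left _ _).trans (le_max_right _ _))
    ((le_max_right _ _).trans (le_max_right _ _))
  have hlt : 4 * Real.log D / δ < ((max n (max n₀ 1) : ℕ) : ℝ) :=
    lt_of_lt_of_le hn (by exact_mod_cast le_max_left _ _)
  rw [div_lt_iff₀ hδ0] at hlt
  linarith

/-- `s ≤ ℓ`, `0 < ℓ` ⇒ `(1/(8√ℓ))·√s ≤ 1/8`. -/
theorem sqrt_rate_le {s ℓ : ℝ} (hsl : s ≤ ℓ) (hℓ : 0 < ℓ) :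
    1 / (8 * Real.sqrt ℓ) * Real.sqrt s ≤ 1 / ((8 : ℕ) : ℝ) := by
  have hl : 0 < Real.sqrt ℓ := Real.sqrt_pos.2 hℓ
  calc 1 / (8 * Real.sqrt ℓ) * Real.sqrt s ≤ 1 / (8 * Real.sqrt ℓ) * Real.sqrt ℓ :=
        mul_le_mul_of_nonneg_left (Real.sqrt_le_sqrt hsl) (by positivity)
    _ = 1 / ((8 : ℕ) : ℝ) := by
        push_cast
        field_simp

/-! ## §2 The strong-coupling plaquette floor on tori (from `PlaquetteLowerBound.wilsonExpectation_plaquette_ge`) -/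

section Plaquette

variable {G : Type} [Group G] [TopologicalSpace G] [IsTopologicalGroup G] [CompactSpace G] [MeasurableSpace G] [BorelSpace G]
  {N : ℕ} (ρ : G →* Matrix (Fin N) (Fin N) ℂ)

/-- **Linear strong-coupling floor for the torus plaquette, uniformly in the volume (`d = 4`):** for the special-unitary fundamental model,
`N ≥ 2`, there are `β₂, c > 0` with `⟨W_{1×1}⟩_{Λ_L, β} ≥ c β` for all `0 < β ≤ β₂` and every torus side `L ≥ 3` (leading order of the
strong-coupling expansion minus the quadratic remainder of the tree's bound). -/
theorem exists_plaquette_ge_linear (hρ : IsSpecialUnitaryModel ρ) (hN : 2 ≤ N) :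
    ∃ β₂ c : ℝ, 0 < β₂ ∧ 0 < c ∧ ∀ β : ℝ, 0 < β → β ≤ β₂ → ∀ (L : ℕ) [NeZero L], 3 ≤ L →
      c * β ≤ wilsonExpectation ρ β (wilsonLoop ρ (0 : Site 4 L) 0 1 1 1) := by
  have hb1 : 0 < betaOne 4 ρ := betaOne_pos 4 (ρ := ρ)
  have hN0 : (0 : ℝ) < N := by exact_mod_cast (show 0 < N by omega)
  have hV : 0 < charVariance ρ := charVariance_pos ρ hρ.1 (by omega)
  obtain ⟨Kc, hKc⟩ : ∃ Kc : ℝ, Kc = (2 * Real.exp (1 / 2)) ^ (4 * (2 ^ 4 * (4 * 4))) := ⟨_, rfl⟩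
  have hKc0 : 0 < Kc := by rw [hKc]; positivity
  obtain ⟨A, hA⟩ : ∃ A : ℝ, A = (N : ℝ)⁻¹ * charVariance ρ * Real.exp (-1) := ⟨_, rfl⟩
  have hA0 : 0 < A := by rw [hA]; positivity
  obtain ⟨B, hB⟩ : ∃ B : ℝ, B = A * betaOne 4 ρ ^ 2 / (2 * Kc) := ⟨_, rfl⟩
  have hB0 : 0 < B := by rw [hB]; positivity
  refine ⟨min (betaOne 4 ρ) (min (1 / (2 * N)) B), A / 2, lt_min hb1 (lt_min (by positivity) hB0), by positivity,
    fun β hβ0 hβ L _ hL => ?_⟩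
  have hβ1 : β ≤ betaOne 4 ρ := hβ.trans (min_le_left _ _)
  have hβN : β ≤ 1 / (2 * N) := hβ.trans ((min_le_right _ _).trans (min_le_left _ _))
  have hβB : β ≤ B := hβ.trans ((min_le_right _ _).trans (min_le_right _ _))
  obtain ⟨L', rfl⟩ : ∃ L', L = L' + 1 := ⟨L - 1, by omega⟩
  have h01 : (0 : Fin 4) ≠ 1 := by decide
  refine le_trans ?_ (wilsonExpectation_plaquette_ge ρ hρ hN h01 (L := L') (by omega) hβ0.le hβ1)
  rw [← hKc]
  have h1 : Real.exp (-1) ≤ Real.exp (-(2 * β * N)) := by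
    refine Real.exp_le_exp.2 ?_
    have : β * (2 * N) ≤ 1 := by rwa [le_div_iff₀ (by positivity)] at hβN
    linarith
  have h2 : Kc * (β / betaOne 4 ρ) ^ 2 ≤ A / 2 * β := by
    have e : Kc * (β / betaOne 4 ρ) ^ 2 = Kc / betaOne 4 ρ ^ 2 * β * β := by ring
    rw [e]
    refine mul_le_mul_of_nonneg_right ?_ hβ0.le
    calc Kc / betaOne 4 ρ ^ 2 * β ≤ Kc / betaOne 4 ρ ^ 2 * B :=
          mul_le_mul_of_nonneg_left hβB (by positivity)
      _ = A / 2 := by rw [hB]; field_simp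
  have h3 : A * β ≤ (N : ℝ)⁻¹ * (β * Real.exp (-(2 * β * N)) * charVariance ρ) := by
    have e : (N : ℝ)⁻¹ * (β * Real.exp (-(2 * β * N)) * charVariance ρ) =
        (N : ℝ)⁻¹ * charVariance ρ * Real.exp (-(2 * β * N)) * β := by ring
    rw [e, hA]
    refine mul_le_mul_of_nonneg_right ?_ hβ0.le
    exact mul_le_mul_of_nonneg_left h1 (by positivity)
  linarith

end Plaquette

/-! ## §3 The window rung -/

/-- **Rung T2-sc-window-RP PROVED.**  For the special-unitary fundamental model (`N ≥ 2`) of a simply-connected compact simple `G`: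
`βD = min β₂ (strongCouplingRadius r.ρ)`; on a window `[β₁, βD]`, `c = 1/(8√(max (−log (c_pl β₁)) 1))`; an area law `(C, s)` for the fundamental
loops on all large even tori caps `s ≤ −log(c_pl β₁)` (RP + plaquette floor), so the strong-coupling cold pressure at rate `1/8 ≥ c√s` is the
asserted `ColdPressureBound` on all large odd tori. -/
theorem ratioStrongCouplingWindowRP_holds : RatioStrongCouplingWindowRP := by
  intro G _ _ _ _ hG hsc
  letI : MeasurableSpace G := borel G
  haveI : BorelSpace G := ⟨rfl⟩
  intro r hSU hN2
  haveI : SecondCountableTopology G :=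
    (r.continuous.isClosedEmbedding r.injective).isEmbedding.secondCountableTopology
  obtain ⟨β₂, cpl, hβ₂, hcpl, hpl⟩ := exists_plaquette_ge_linear r.ρ hSU hN2
  have hR0 := strongCouplingRadius_pos r.ρ
  refine ⟨min β₂ (strongCouplingRadius r.ρ), lt_min hβ₂ hR0, fun β₁ hβ₁ hβ₁D => ?_⟩
  obtain ⟨w, hw⟩ : ∃ w : ℝ, w = cpl * β₁ := ⟨_, rfl⟩
  have hw0 : 0 < w := by rw [hw]; exact mul_pos hcpl hβ₁
  obtain ⟨ℓ, hℓ⟩ : ∃ ℓ : ℝ, ℓ = max (-Real.log w) 1 := ⟨_, rfl⟩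
  have hℓ0 : 0 < ℓ := by rw [hℓ]; exact lt_of_lt_of_le one_pos (le_max_right _ _)
  refine ⟨1 / (8 * Real.sqrt ℓ), by positivity, fun β hβ₁β hββD s hs C hAL => ?_⟩
  have hβ0 : 0 < β := hβ₁.trans_le hβ₁β
  have hβ2 : β ≤ β₂ := hββD.trans (min_le_left _ _)
  have hβR : β ≤ strongCouplingRadius r.ρ := hββD.trans (min_le_right _ _)
  obtain ⟨L₂, hL₂⟩ := hAL
  -- the rate cap `s ≤ -log w`
  have hcap : s ≤ -Real.log w := by
    refine rate_le_neg_log_of_areaLaw hw0 (D := |C| + 1) (by linarith [abs_nonneg C]) (n₀ := max L₂ 2) fun n hn => ?_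
    have hn2 : 2 ≤ n := le_trans (le_max_right _ _) hn
    have hnL : L₂ ≤ 2 * n := le_trans (le_max_left _ _) (le_trans hn (by omega))
    haveI : NeZero (2 * n) := ⟨by omega⟩
    have hE : Even (2 * n) := even_two_mul n
    have hS := plaquette_pow_le_wilsonExpectation_wilsonLoopRep (d := 4) (L := 2 * n) r.ρ r.ρ (by norm_num) hE r.continuous
      hβ0.le r.continuous (show r.N ≠ 0 by omega) (h := n) (R := n) (by omega) (by omega)
    have hP := hpl β hβ0 hβ2 (2 * n) (by omega)
    have hwP : w ≤ wilsonExpectation r.ρ β (wilsonLoop r.ρ (0 : Site 4 (2 * n)) 0 1 1 1) := by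
      rw [hw]; exact le_trans (mul_le_mul_of_nonneg_left hβ₁β hcpl.le) hP
    have hA := hL₂ (2 * n) hnL hE n n (by omega) (by omega) le_rfl le_rfl
    calc w ^ (n * n) ≤ wilsonExpectation r.ρ β (wilsonLoop r.ρ (0 : Site 4 (2 * n)) 0 1 1 1) ^ (n * n) :=
          pow_le_pow_left₀ hw0.le hwP _
      _ ≤ wilsonExpectation r.ρ β (wilsonLoop r.ρ (0 : Site 4 (2 * n)) 0 1 n n) := hS
      _ ≤ |wilsonExpectation r.ρ β (wilsonLoop r.ρ (0 : Site 4 (2 * n)) 0 1 n n)| := le_abs_self _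
      _ ≤ C ^ (2 * (n + n)) * Real.exp (-(s * n * n)) := hA
      _ ≤ (|C| + 1) ^ (2 * (n + n)) * Real.exp (-(s * n * n)) := by
          refine mul_le_mul_of_nonneg_right ?_ (Real.exp_pos _).le
          calc C ^ (2 * (n + n)) ≤ |C ^ (2 * (n + n))| := le_abs_self _
            _ = |C| ^ (2 * (n + n)) := abs_pow _ _
            _ ≤ (|C| + 1) ^ (2 * (n + n)) := pow_le_pow_left₀ (abs_nonneg _) (by linarith) _
  -- cold pressure at rate `1/8`, lowered to `c√s ≤ 1/8`
  obtain ⟨C₀, S₁, hC₀, hcp⟩ := coldPressureAt_strongCoupling r hβ0.le hβR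
  refine ⟨C₀, hC₀, S₁, fun S hS => coldPressureBound_mono_rate (hcp S hS) hC₀ ?_⟩
  have hsl : s ≤ ℓ := hcap.trans (by rw [hℓ]; exact le_max_left _ _)
  exact sqrt_rate_le hsl hℓ0

end Summit.QuantumFields.YangMills.Cruxes.IR.TensionRatio

end
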